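import Literature.Topology.FourManifolds.BordismFourUnorientedCount
import Literature.Topology.FourManifolds.BordismFourProofs
import Literature.Topology.FourManifolds.BordismFourDisjointUnion
import Literature.Topology.FourManifolds.BordismReflProofs
import Literature.Topology.FourManifolds.IntersectionFormTopologyRankProofs
import Literature.Topology.FourManifolds.IntersectionLatticeProofs
import Literature.AlgebraicTopology.SingularHomology.PoincareDualityCorollaries
import Literature.AlgebraicTopology.SingularHomology.OrientationProofs
import Literature.AlgebraicTopology.SingularHomology.IntersectionFormProofs
import HarnessLib

/-!
# The orientable classes of `𝔑₄`: `Ω⁴ → 𝔑⁴` has image `{0, [ℂℙ²]}`, given Thom's Thm IV.13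

R. Thom, *Quelques propriétés globales des variétés différentiables*, Comment. Math. Helv. 28
(1954): Thm IV.13 (p. 81: `Ω⁴ = ℤ`, "le générateur de `Ω⁴` est représenté par le plan projectif
complexe `PC(2)`") and Thm IV.12 with "Les générateurs pour les petites dimensions" (pp. 79–80:
`𝔑⁴ ≅ ℤ₂ + ℤ₂`, the classes being separated by `w₄ = χ mod 2` and `w₁⁴`).  Forgetting
orientations maps `Ω⁴ = ℤ·[PC(2)]` onto the subgroup `{0, [PC(2)]}` of `𝔑⁴`, and on that
subgroup the single Stiefel–Whitney number `w₄[M] = χ(M) mod 2` already separates the classes: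
for an ORIENTED closed 4-manifold `χ(M) ≡ σ(M) (mod 2)` (Poincaré duality: `b₀ = b₄`, `b₁ = b₃`,
and `σ = b₂⁺ − b₂⁻ ≡ b₂⁺ + b₂⁻ = b₂`), while `σ` classifies `Ω⁴`.

This file PROVES that half of Thom's Thm IV.10 at `k = 4` ("all Stiefel–Whitney numbers zero ⟹
the manifold bounds") which concerns ORIENTABLE manifolds, relative to the tree's one open named
fact on `Ω⁴`, `Literature.Topology.FourManifolds.isOrientedBordant_of_signature_eq` (Thm IV.13,
hypothesis `hX`; its seat is `BordismFourProofs` / `BordismFourNullBordism` /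
`BordismFourOrientableBoundary`).  Everything else is a theorem of the tree:

* §1 `UnorientedBordismClass.mk_eq_mk_of_cobordism`, `IsOrientedBordant.unorientedBordismClass_mk_eq`
  — a cobordism, in particular an oriented bordism, gives equal classes in `𝔑ₙ` (Thom 1954,
  Ch. IV §1: `Ωₙ → 𝔑ₙ` forgets the orientation); `UnorientedBordismClass.mk_sum` —
  `[M ⊔ N] = [M] + [N]` (the sum of `𝔑ₙ`, Milnor–Stasheff 1974 §17; the cylinder
  `cylinderCobordism` of the tree);
* §2 `finrank_singularHomology_eq_of_add_eq_four` (`b_p = b_{4-p}` over `ℤ`, from the tree's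
  PROVED Poincaré duality over `ℚ`, `bettiNumber_eq_bettiNumber_of_add_eq_holds`, Hatcher
  Cor. 3.37, and `b_k(ℤ) = b_k(ℚ)`, `bettiNumber_int_eq_rat`, Hatcher Cor. 3A.6) and
  **`HomologicalOrientation.intCast_signature_eq_intCast_intEulerChar`: `σ(M, μ) ≡ χ(M) (mod 2)`**
  (`b₂ = b₂⁺ + b₂⁻`, the tree's PROVED `finrank_eq_sigPos_add_sigNeg_intersectionForm_holds`,
  Milnor–Husemoller §V.1; Hirzebruch–Milnor parity, Milnor–Stasheff 1974 §19 Problem 19-C /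
  Kirby 1989 Ch. II §2);
* §3 `exists_signature_eq_and_mk_eq` — for every `m : ℕ` a closed `ℤ`-oriented smooth
  4-manifold of signature `m` whose class in `𝔑₄` is `0` for `m` even and `[ℂℙ²]` for `m` odd
  (`(ℂℙ² ⊔ ℂℙ²̄) ⊔ ℂℙ² ⊔ ⋯ ⊔ ℂℙ²`: Thom p. 81, `σ` additive (`signature_sum`), `σ(ℂℙ²) = 1`
  (`exists_signature_complexProjectivePlane_eq_one_holds`), `σ(−M) = −σ(M)`
  (`signature_neg_holds`), and `a + a = 0` in `𝔑₄`);
* §4 **`UnorientedBordismClass.mk_eq_of_homologicalOrientation`** — GIVEN Thm IV.13 (`hX`), the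
  class in `𝔑₄` of a closed `ℤ`-oriented smooth 4-manifold `(M, μ)` is `0` if `σ(M, μ)` is even
  and `[ℂℙ²]` if it is odd; hence (`…_of_eulerCharModTwo_eq_zero/one`) it is `0` iff `χ(M)` is
  even, i.e. **an orientable closed 4-manifold with `w₄[M] = χ(M) mod 2 = 0` bounds mod 2** —
  Thom's Thm IV.10 at `k = 4` on the image of `Ω⁴` (where `w₁ = 0` kills every other number) —
  and **`UnorientedBordismClass.thomInvariant_injective_of_orientable`**: Thom's invariant
  `(χ mod 2, v₁⁴)` (`BordismFourUnorientedCount.lean`) is injective on orientable classes.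

With `BordismFourRealProjectiveFour.natCard_unorientedBordismClass_four_of_injective` this
isolates what is still missing for `Literature.Topology.FourManifolds.natCard_unorientedBordismClass_four`
(`|𝔑₄| = 4`) beyond Thm IV.13: injectivity of `thomInvariant` OFF the image of `Ω⁴`, i.e. that a
closed 4-manifold with `w₁⁴[M] = 0` is bordant mod 2 to an orientable one (Thom 1954, Thm IV.12
at `k = 4`: the classes with `w₁⁴ = 0` are `0` and `[PC(2)]`; C. T. C. Wall, Ann. of Math. 72
(1960), the image of `Ω → 𝔑`) — the Pontryagin–Thom computation, not in the tree.  No `sorry`,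
no new definitions, no named facts (D-0026).

## References

* R. Thom, *Quelques propriétés globales des variétés différentiables*, Comment. Math. Helv. 28
  (1954), 17–86: Ch. IV §1 (p. 64), Thm IV.10–IV.12 (pp. 77–80), Thm IV.13 (p. 81).
  [ThomCMH1954]
* J. W. Milnor, J. D. Stasheff, *Characteristic Classes*, Ann. of Math. Studies 76 (1974), §4
  Cor. 11.12 (`w_n[M] = χ(M) mod 2`), §17 (the groups `𝔑ₙ`, `Ωₙ`), §19. [MilnorStasheff1974]
* J. Milnor, D. Husemoller, *Symmetric Bilinear Forms*, Springer (1973), §II.2, §V.1.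
  [MilnorHusemoller1973]
* A. Hatcher, *Algebraic Topology*, CUP (2002), §3.3 Cor. 3.37, §3.A Cor. 3A.6. [HatcherAT2002]
-/

noncomputable section

open scoped Manifold ContDiff
open CategoryTheory Set Function
open Literature.AlgebraicTopology.SingularHomology

namespace Literature.Topology.FourManifolds

universe u

/-! ### §1 Forgetting the orientation: `Ωₙ → 𝔑ₙ`, and `[M ⊔ N] = [M] + [N]` -/

section Forget

variable {n : ℕ} {M N : Type u}
  [TopologicalSpace M] [T2Space M] [ChartedSpace (EuclideanSpace ℝ (Fin n)) M]
  [IsManifold (𝓡 n) ∞ M] [CompactSpace M] [BoundarylessManifold (𝓡 n) M]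
  [TopologicalSpace N] [T2Space N] [ChartedSpace (EuclideanSpace ℝ (Fin n)) N]
  [IsManifold (𝓡 n) ∞ N] [CompactSpace N] [BoundarylessManifold (𝓡 n) N]

/-- **A cobordism from `M` to `N` gives `[M] = [N]` in `𝔑ₙ`** (Thom 1954, Ch. IV §1, p. 64:
"`V ≃ V'`" iff `V' − V` bounds; over the point the singular structure maps are constant).
[cite: ThomCMH1954, Ch. IV §1 p. 64] -/
theorem UnorientedBordismClass.mk_eq_mk_of_cobordism (c : Cobordism n M N) :
    (UnorientedBordismClass.mk M : UnorientedBordismClass.{u} n) = UnorientedBordismClass.mk N :=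
  BordismClass.sound
    ⟨c, ⟨fun _ => PUnit.unit, continuous_const⟩, fun _ => Subsingleton.elim _ _,
      fun _ => Subsingleton.elim _ _⟩

/-- **Oriented bordant ⟹ bordant mod 2**: the forgetful map `Ωₙ → 𝔑ₙ` (Thom 1954, Ch. IV §1;
Milnor–Stasheff 1974, §17) — an oriented bordism `(W, w)` between `(M, μ)` and `(N, ν)` is in
particular a cobordism `W` from `M` to `N`. [cite: ThomCMH1954, Ch. IV §1 p. 64] [cite: MilnorStasheff1974, §17] -/
theorem IsOrientedBordant.unorientedBordismClass_mk_eq {μ : HomologicalOrientation ℤ M n}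
    {ν : HomologicalOrientation ℤ N n} (h : IsOrientedBordant n μ ν) :
    (UnorientedBordismClass.mk M : UnorientedBordismClass.{u} n) = UnorientedBordismClass.mk N := by
  obtain ⟨c, -, -⟩ := h
  exact UnorientedBordismClass.mk_eq_mk_of_cobordism c

/-- **`[M ⊔ N] = [M] + [N]` in `𝔑ₙ`** (the sum of bordism classes is disjoint union of
representatives, Milnor–Stasheff 1974, §17; here the closed manifold `M ⊔ N` over the point is
bordant — through its cylinder, `ClosedSingularManifold.isBordant_self` — to the disjoint union of
the singular manifolds `M`, `N` over the point). [cite: MilnorStasheff1974, §17] -/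
theorem UnorientedBordismClass.mk_sum [ClosedSingularManifold.BordismFacts.{u} PUnit.{u + 1} n] :
    (UnorientedBordismClass.mk (M ⊕ N) : UnorientedBordismClass.{u} n) =
      UnorientedBordismClass.mk M + UnorientedBordismClass.mk N := by
  rw [UnorientedBordismClass.mk_eq, UnorientedBordismClass.mk_eq, UnorientedBordismClass.mk_eq,
    BordismClass.mk_add_mk]
  apply BordismClass.sound
  obtain ⟨c, F, -, -⟩ :=
    ClosedSingularManifold.isBordant_self (ClosedSingularManifold.ofManifold n (M ⊕ N))
  exact ⟨c, F, fun _ => Subsingleton.elim _ _, fun _ => Subsingleton.elim _ _⟩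

end Forget

/-! ### §2 `σ(M, μ) ≡ χ(M) (mod 2)` for a closed oriented 4-manifold -/

section SignatureParity

variable {M : Type u} [TopologicalSpace M] [T2Space M] [ChartedSpace (EuclideanSpace ℝ (Fin 4)) M]
  [CompactSpace M]

/-- **`b_p(M) = b_q(M)` for `p + q = 4`** (ranks of `Hₚ(M; ℤ)`) on a closed `ℤ`-oriented
topological 4-manifold: `b_k(ℤ) = b_k(ℚ)` (Hatcher Cor. 3A.6, `bettiNumber_int_eq_rat`), `M` is
`ℚ`-oriented (`isOrientableOver_of_int_holds`), and Poincaré duality with universal coefficients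
over the field `ℚ` (Hatcher Cor. 3.37, `bettiNumber_eq_bettiNumber_of_add_eq_holds`).
[cite: HatcherAT2002, §3.3 Cor. 3.37 and §3.A Cor. 3A.6] -/
theorem finrank_singularHomology_eq_of_add_eq_four (μ : HomologicalOrientation ℤ M 4) {p q : ℕ}
    (h : p + q = 4) :
    Module.finrank ℤ (singularHomology ℤ ℤ M p) = Module.finrank ℤ (singularHomology ℤ ℤ M q) := by
  have hq : IsOrientableOver ℚ M 4 := isOrientableOver_of_int_holds M ℚ ⟨μ⟩
  have e := bettiNumber_eq_bettiNumber_of_add_eq_holds ℚ M 4 hq h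
  rw [← bettiNumber_int_eq_rat, ← bettiNumber_int_eq_rat] at e
  exact e

/-- **`σ(M, μ) ≡ χ(M) (mod 2)` for a closed `ℤ`-oriented smooth 4-manifold.**  With
`b_k = rank H_k(M; ℤ)`: `χ = b₀ − b₁ + b₂ − b₃ + b₄ = 2b₀ − 2b₁ + b₂` (`b₀ = b₄`, `b₁ = b₃`,
`finrank_singularHomology_eq_of_add_eq_four`), `b₂ = rank (H²(M; ℤ)/T) = b₂⁺ + b₂⁻`
(`finrank_freeCohomology_two_eq_bettiNumber_of_compactSpace`,
`finrank_eq_sigPos_add_sigNeg_intersectionForm_holds`, Milnor–Husemoller §V.1) and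
`σ = b₂⁺ − b₂⁻`; so `χ − σ = 2(b₀ − b₁ + b₂⁻)`.  (Milnor–Stasheff 1974, §19; Kirby 1989, Ch. II.)
Here `χ(M)` is the tree's `ClosedSingularManifold.intEulerChar` of `M` over the point, the
integer behind `UnorientedBordismClass.eulerCharModTwo`. [cite: MilnorHusemoller1973, §II.2 and §V.1] [cite: MilnorStasheff1974, §19] -/
theorem _root_.Literature.AlgebraicTopology.SingularHomology.HomologicalOrientation.intCast_signature_eq_intCast_intEulerChar
    [SecondCountableTopology M] [IsManifold (𝓡 4) ∞ M] (μ : HomologicalOrientation ℤ M 4) :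
    ((μ.signature : ℤ) : ZMod 2) =
      ((ClosedSingularManifold.ofManifold 4 M).intEulerChar : ZMod 2) := by
  -- the Betti numbers `b_k = rank H_k(M; ℤ)` and their symmetry
  set b : ℕ → ℕ := fun i => Module.finrank ℤ (singularHomology ℤ ℤ M i) with hb
  have h04 : b 0 = b 4 :=
    finrank_singularHomology_eq_of_add_eq_four μ (show 0 + 4 = 4 by norm_num)
  have h13 : b 1 = b 3 :=
    finrank_singularHomology_eq_of_add_eq_four μ (show 1 + 3 = 4 by norm_num)
  -- `b₂ = b₂⁺ + b₂⁻`
  have h2 : b 2 = sigPos (intersectionForm two_add_two_eq_four μ).toQuadraticMap +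
      sigNeg (intersectionForm two_add_two_eq_four μ).toQuadraticMap := by
    have e1 := finrank_eq_sigPos_add_sigNeg_intersectionForm_holds (X := M) even_two
      two_add_two_eq_four μ
    have e2 : Module.finrank ℤ (freeCohomology ℤ M 2) = b 2 := by
      rw [finrank_freeCohomology_two_eq_bettiNumber_of_compactSpace, ← bettiNumber_int_eq_rat]
      rfl
    rw [← e2, e1]
  -- `σ = b₂⁺ - b₂⁻`
  have hσ : μ.signature = (sigPos (intersectionForm two_add_two_eq_four μ).toQuadraticMap : ℤ) -
      sigNeg (intersectionForm two_add_two_eq_four μ).toQuadraticMap := rfl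
  -- `χ = b₀ - b₁ + b₂ - b₃ + b₄`
  have hχ' : (ClosedSingularManifold.ofManifold 4 M).intEulerChar =
      ∑ i ∈ Finset.range (4 + 1), (-1 : ℤ) ^ i * (b i : ℤ) := rfl
  have hχ : (ClosedSingularManifold.ofManifold 4 M).intEulerChar =
      (b 0 : ℤ) - b 1 + b 2 - b 3 + b 4 := by
    rw [hχ']
    simp only [Finset.sum_range_succ, Finset.sum_range_zero]
    ring
  have key : (ClosedSingularManifold.ofManifold 4 M).intEulerChar =
      μ.signature + 2 * ((b 0 : ℤ) - b 1 +
        sigNeg (intersectionForm two_add_two_eq_four μ).toQuadraticMap) := by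
    rw [hχ, hσ, ← h04, ← h13, h2]
    push_cast
    ring
  rw [key]
  push_cast
  rw [show (2 : ZMod 2) = 0 from rfl, zero_mul, add_zero]

/-- **`χ(M) mod 2 = σ(M, μ) mod 2` on `𝔑₄`**: the first coordinate of Thom's invariant
`UnorientedBordismClass.thomInvariant` on the class of a closed `ℤ`-oriented smooth 4-manifold is
the parity of its signature. [cite: MilnorStasheff1974, §19] [cite: ThomCMH1954, Thm IV.13 (p. 81)] -/
theorem UnorientedBordismClass.eulerCharModTwo_mk_eq_intCast_signature
    [SecondCountableTopology M] [IsManifold (𝓡 4) ∞ M] (μ : HomologicalOrientation ℤ M 4) :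
    UnorientedBordismClass.eulerCharModTwo (UnorientedBordismClass.mk M : UnorientedBordismClass.{u} 4) =
      ((μ.signature : ℤ) : ZMod 2) := by
  rw [UnorientedBordismClass.mk_eq, UnorientedBordismClass.eulerCharModTwo_mk,
    μ.intCast_signature_eq_intCast_intEulerChar]

/-- `χ(M)` is even iff `σ(M, μ)` is even, for a closed `ℤ`-oriented smooth 4-manifold
(`eulerCharModTwo [M] = 0 ↔ Even σ`). [cite: MilnorStasheff1974, §19] -/
theorem UnorientedBordismClass.eulerCharModTwo_mk_eq_zero_iff_even_signature
    [SecondCountableTopology M] [IsManifold (𝓡 4) ∞ M] (μ : HomologicalOrientation ℤ M 4) :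
    UnorientedBordismClass.eulerCharModTwo (UnorientedBordismClass.mk M : UnorientedBordismClass.{u} 4) = 0 ↔
      Even μ.signature := by
  rw [UnorientedBordismClass.eulerCharModTwo_mk_eq_intCast_signature μ,
    ZMod.intCast_zmod_eq_zero_iff_dvd, even_iff_two_dvd]
  norm_cast

end SignatureParity

/-! ### §3 Standard oriented 4-manifolds: `k` copies of `ℂℙ²` -/

/-- **For every `m : ℕ` there is a closed `ℤ`-oriented smooth 4-manifold of signature `m` whose
class in `𝔑₄` is `0` for `m` even and `[ℂℙ²]` for `m` odd**: `(ℂℙ² ⊔ ℂℙ²̄) ⊔ ℂℙ² ⊔ ⋯ ⊔ ℂℙ²`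
with `m` further copies of `ℂℙ²` (Thom 1954, Thm IV.13 p. 81: `PC(2)` generates `Ω⁴ = ℤ`, and
p. 80: its class in `𝔑⁴`; `σ` is additive, `signature_sum`, `σ(ℂℙ²) = 1`, `σ(−ℂℙ²) = −1`, and
`[ℂℙ²] + [ℂℙ²] = 0` in `𝔑₄`). [cite: ThomCMH1954, Thm IV.13 (p. 81) and pp. 79–80] -/
theorem exists_signature_eq_and_mk_eq (m : ℕ) :
    ∃ (N : Type) (_ : TopologicalSpace N) (_ : T2Space N) (_ : SecondCountableTopology N)
      (_ : ChartedSpace (EuclideanSpace ℝ (Fin 4)) N) (_ : CompactSpace N) (_ : IsManifold (𝓡 4) ∞ N)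
      (ν : HomologicalOrientation ℤ N 4),
      ν.signature = m ∧
        (UnorientedBordismClass.mk N : UnorientedBordismClass.{0} 4) =
          if Even m then 0 else UnorientedBordismClass.mk ComplexProjectivePlane := by
  haveI := ClosedSingularManifold.bordismFacts_succ (Y := PUnit.{1}) (n := 3)
  obtain ⟨μ₁, hμ₁⟩ := exists_signature_complexProjectivePlane_eq_one_holds
  induction m with
  | zero =>
    -- `ℂℙ² ⊔ ℂℙ²̄`: signature `1 - 1 = 0`, class `[ℂℙ²] + [ℂℙ²] = 0`
    obtain ⟨ξ, hξ₁, hξ₂⟩ := HomologicalOrientation.exists_sum ℤ μ₁ (-μ₁)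
    refine ⟨ComplexProjectivePlane ⊕ ComplexProjectivePlane, inferInstance, inferInstance,
      inferInstance, inferInstance, inferInstance, inferInstance, ξ, ?_, ?_⟩
    · rw [HomologicalOrientation.signature_sum μ₁ (-μ₁) ξ hξ₁ hξ₂,
        HomologicalOrientation.signature_neg_holds μ₁, hμ₁]
      norm_num
    · rw [if_pos Even.zero, UnorientedBordismClass.mk_sum, BordismClass.add_self_eq_zero]
  | succ m ih =>
    obtain ⟨N, _, _, _, _, _, _, ν, hν, hcl⟩ := ih
    obtain ⟨ξ, hξ₁, hξ₂⟩ := HomologicalOrientation.exists_sum ℤ ν μ₁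
    refine ⟨N ⊕ ComplexProjectivePlane, inferInstance, inferInstance, inferInstance,
      inferInstance, inferInstance, inferInstance, ξ, ?_, ?_⟩
    · rw [HomologicalOrientation.signature_sum ν μ₁ ξ hξ₁ hξ₂, hν, hμ₁]
      push_cast
      ring
    · rw [UnorientedBordismClass.mk_sum, hcl]
      by_cases hm : Even m
      · rw [if_pos hm, if_neg (Nat.even_add_one.not.mpr (not_not.mpr hm)), BordismClass.zero_add]
      · rw [if_neg hm, if_pos (Nat.even_add_one.mpr hm), BordismClass.add_self_eq_zero]

/-! ### §4 The orientable classes of `𝔑₄`, given Thom's Thm IV.13 -/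

section Orientable

variable {M : Type} [TopologicalSpace M] [T2Space M] [SecondCountableTopology M]
  [ChartedSpace (EuclideanSpace ℝ (Fin 4)) M] [CompactSpace M] [IsManifold (𝓡 4) ∞ M]

/-- **The class in `𝔑₄` of a closed `ℤ`-oriented smooth 4-manifold, given Thom's Thm IV.13**
(`hX : isOrientedBordant_of_signature_eq`, the tree's open named fact `Ω⁴ ↪ ℤ` via `σ`): it is
`0` if `σ(M, μ)` is even and `[ℂℙ²]` if `σ(M, μ)` is odd.  Proof: after possibly reversing `μ`
(`σ(−M) = −σ(M)`, same class in `𝔑₄`) `σ(M, μ) = m ≥ 0`; by IV.13 `(M, μ)` is oriented bordant to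
the standard manifold of §3 of signature `m`, hence has the same class in `𝔑₄` (§1).  Thom 1954,
p. 81 with pp. 79–80: the image of `Ω⁴ = ℤ·[PC(2)]` in `𝔑⁴`. [cite: ThomCMH1954, Thm IV.13 (p. 81) and pp. 79–80] -/
theorem UnorientedBordismClass.mk_eq_of_homologicalOrientation
    (hX : isOrientedBordant_of_signature_eq.{0}) (μ : HomologicalOrientation ℤ M 4) :
    (UnorientedBordismClass.mk M : UnorientedBordismClass.{0} 4) =
      if Even μ.signature then 0 else UnorientedBordismClass.mk ComplexProjectivePlane := by
  -- reduce to a non-negative signature by reversing the orientation if necessary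
  suffices key : ∀ (θ : HomologicalOrientation ℤ M 4) (m : ℕ), θ.signature = m →
      (UnorientedBordismClass.mk M : UnorientedBordismClass.{0} 4) =
        if Even m then 0 else UnorientedBordismClass.mk ComplexProjectivePlane by
    rcases le_or_gt 0 μ.signature with hs | hs
    · obtain ⟨m, hm⟩ : ∃ m : ℕ, μ.signature = m := ⟨μ.signature.toNat, by omega⟩
      rw [key μ m hm]
      simp only [hm, Int.even_coe_nat]
    · obtain ⟨m, hm⟩ : ∃ m : ℕ, (-μ).signature = m := by
        refine ⟨(-μ.signature).toNat, ?_⟩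
        rw [HomologicalOrientation.signature_neg_holds μ]
        omega
      rw [key (-μ) m hm]
      rw [HomologicalOrientation.signature_neg_holds μ] at hm
      have hm' : μ.signature = -(m : ℤ) := by omega
      simp only [hm', even_neg, Int.even_coe_nat]
  intro θ m hm
  obtain ⟨N, _, _, _, _, _, _, ν, hν, hcl⟩ := exists_signature_eq_and_mk_eq m
  have hb : IsOrientedBordant 4 θ ν := hX θ ν (by rw [hm, hν])
  rw [hb.unorientedBordismClass_mk_eq, hcl]

/-- **An orientable closed 4-manifold with `χ(M)` even bounds mod 2, given Thm IV.13** — Thom's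
Thm IV.10 at `k = 4` on the image of `Ω⁴` (there `w₁ = 0`, so `w₄[M] = χ(M) mod 2` is the only
Stiefel–Whitney number; Thom 1954, Thm IV.10 p. 77 and p. 81). [cite: ThomCMH1954, Thm IV.10 (p. 77) and Thm IV.13 (p. 81)] -/
theorem UnorientedBordismClass.mk_eq_zero_of_eulerCharModTwo_eq_zero
    (hX : isOrientedBordant_of_signature_eq.{0}) (μ : HomologicalOrientation ℤ M 4)
    (hχ : UnorientedBordismClass.eulerCharModTwo
      (UnorientedBordismClass.mk M : UnorientedBordismClass.{0} 4) = 0) :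
    (UnorientedBordismClass.mk M : UnorientedBordismClass.{0} 4) = 0 := by
  rw [UnorientedBordismClass.mk_eq_of_homologicalOrientation hX μ,
    if_pos ((UnorientedBordismClass.eulerCharModTwo_mk_eq_zero_iff_even_signature μ).1 hχ)]

/-- **An orientable closed 4-manifold with `χ(M)` odd is bordant mod 2 to `ℂℙ²`, given
Thm IV.13** (Thom 1954, pp. 79–81: `PC(2)` represents the non-zero orientable class of `𝔑⁴`).
[cite: ThomCMH1954, Thm IV.13 (p. 81) and pp. 79–80] -/
theorem UnorientedBordismClass.mk_eq_mk_complexProjectivePlane_of_eulerCharModTwo_ne_zero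
    (hX : isOrientedBordant_of_signature_eq.{0}) (μ : HomologicalOrientation ℤ M 4)
    (hχ : UnorientedBordismClass.eulerCharModTwo
      (UnorientedBordismClass.mk M : UnorientedBordismClass.{0} 4) ≠ 0) :
    (UnorientedBordismClass.mk M : UnorientedBordismClass.{0} 4) =
      UnorientedBordismClass.mk ComplexProjectivePlane := by
  rw [UnorientedBordismClass.mk_eq_of_homologicalOrientation hX μ, if_neg]
  exact fun h => hχ ((UnorientedBordismClass.eulerCharModTwo_mk_eq_zero_iff_even_signature μ).2 h)

/-- **The image of `Ω⁴ → 𝔑⁴` is `{0, [ℂℙ²]}`, given Thm IV.13**: the class of every orientable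
closed smooth 4-manifold is `0` or `[ℂℙ²]` (Thom 1954, p. 81 with pp. 79–80).
[cite: ThomCMH1954, Thm IV.13 (p. 81) and pp. 79–80] -/
theorem UnorientedBordismClass.mk_eq_zero_or_eq_mk_complexProjectivePlane
    (hX : isOrientedBordant_of_signature_eq.{0}) (hM : IsOrientableOver ℤ M 4) :
    (UnorientedBordismClass.mk M : UnorientedBordismClass.{0} 4) = 0 ∨
      (UnorientedBordismClass.mk M : UnorientedBordismClass.{0} 4) =
        UnorientedBordismClass.mk ComplexProjectivePlane := by
  obtain ⟨μ⟩ := hM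
  rw [UnorientedBordismClass.mk_eq_of_homologicalOrientation hX μ]
  split_ifs
  · exact Or.inl rfl
  · exact Or.inr rfl

variable {N : Type} [TopologicalSpace N] [T2Space N] [SecondCountableTopology N]
  [ChartedSpace (EuclideanSpace ℝ (Fin 4)) N] [CompactSpace N] [IsManifold (𝓡 4) ∞ N]

/-- **Thom's invariant `(χ mod 2, v₁⁴)` is injective on the orientable classes of `𝔑₄`, given
Thm IV.13**: two orientable closed smooth 4-manifolds with `χ(M) ≡ χ(N) (mod 2)` are bordant
mod 2 (both classes are `0` or `[ℂℙ²]` according to that parity) — the orientable half of the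
injectivity hypothesis `hUB` of
`Literature.Topology.FourManifolds.natCard_unorientedBordismClass_four_of_injective` (Thom 1954,
Thm IV.10/Cor. IV.11 at `k = 4`). [cite: ThomCMH1954, Thm IV.10, Cor. IV.11 (p. 77) and Thm IV.13 (p. 81)] -/
theorem UnorientedBordismClass.thomInvariant_injective_of_orientable
    (hX : isOrientedBordant_of_signature_eq.{0}) (hM : IsOrientableOver ℤ M 4)
    (hN : IsOrientableOver ℤ N 4)
    (h : UnorientedBordismClass.thomInvariant (UnorientedBordismClass.mk M : UnorientedBordismClass.{0} 4) =
      UnorientedBordismClass.thomInvariant (UnorientedBordismClass.mk N : UnorientedBordismClass.{0} 4)) :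
    (UnorientedBordismClass.mk M : UnorientedBordismClass.{0} 4) = UnorientedBordismClass.mk N := by
  obtain ⟨μ⟩ := hM
  obtain ⟨ν⟩ := hN
  have h1 : UnorientedBordismClass.eulerCharModTwo (UnorientedBordismClass.mk M : UnorientedBordismClass.{0} 4) =
      UnorientedBordismClass.eulerCharModTwo (UnorientedBordismClass.mk N : UnorientedBordismClass.{0} 4) :=
    congrArg Prod.fst h
  have h2 : Even μ.signature ↔ Even ν.signature := by
    rw [← UnorientedBordismClass.eulerCharModTwo_mk_eq_zero_iff_even_signature μ,
      ← UnorientedBordismClass.eulerCharModTwo_mk_eq_zero_iff_even_signature ν, h1]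
  rw [UnorientedBordismClass.mk_eq_of_homologicalOrientation hX μ,
    UnorientedBordismClass.mk_eq_of_homologicalOrientation hX ν]
  by_cases hμ : Even μ.signature
  · rw [if_pos hμ, if_pos (h2.1 hμ)]
  · rw [if_neg hμ, if_neg (fun hν => hμ (h2.2 hν))]

end Orientable

end Literature.Topology.FourManifolds
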